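import Literature.AlgebraicGeometry.AbelianVarieties.HomogeneousLineBundleMulPullback
import Literature.AlgebraicGeometry.AbelianSchemes.IsLambdaOfAtBezout
import Literature.AlgebraicGeometry.Motives.AbelianVarietyTranslation
import HarnessLib

/-!
# A translation-invariant, symmetric divisor class on an abelian variety is `2`-torsion: `2•Z ∼ 0`

Layer `Literature/AlgebraicGeometry/AbelianVarieties`, namespace `Literature.AlgebraicGeometry.AbelianVarieties`.  THEOREMS ONLY.
Cell hodgecm-mathlib (D-0151), Hecke-link socket (B), (X-amp) plan of record (B-plan1 (g14) 22:05:45Z), fact **(F5)** of census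
`CENSUS-Xamp3-existsAmple` §2 — the `2`-TORSION DEFECT input `h2` of ★ `exists_isAmple_isLambdaOfAt_bezout` (p748191):
[MumfordAV1970] §8 (ii)–(iv): for `L ∈ Pic⁰(B)` (translation-invariant), `(f+g)^*L ≅ f^*L ⊗ g^*L` (★ (⊗-3)
`cechPic_pullback_hom_mul_detClass`, p746098), whence with `f = 1`, `g = −1`: `𝒪 ≅ 0^*L ≅ L ⊗ (−1)^*L`, i.e. **`(−1)^*[L] = [L]⁻¹`**;
if moreover `L` is SYMMETRIC (`(−1)^*L ≅ L`) then `[L]² = 1`.  In divisor currency (`Z` a Cartier divisor on `B`,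
`[𝒪(Z)] = Z.cechClass`):

* `cechClass_classPullback_inv_eq_inv` — `[(−1)^*Z] = [Z]⁻¹` for translation-invariant `Z`;
* **`two_smul_linEquiv_zero_of_translationInvariant_of_symmetric`** — `2 • Z ∼ 0`;
* `smul_linEquiv_smul_of_sub_two_torsion` — the shape consumed by ★ `exists_isAmple_isLambdaOfAt_bezout`:
  from `2 • (m•Θ_B + (−Θ₀)) ∼ 0` conclude `(2m) • Θ_B ∼ 2 • Θ₀`.

## References

* [MumfordAV1970] D. Mumford, *Abelian Varieties* (1970), §8 (ii)–(iv) (pp. 74–75) (`(f+g)^*L`, `n^*L ≅ L^{n}` on `Pic⁰`; `(−1)^*L ≅ L⁻¹`).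
-/

noncomputable section

open CategoryTheory CategoryTheory.Limits AlgebraicGeometry MonoidalCategory CartesianMonoidalCategory
open scoped MonObj

universe u

namespace Literature.AlgebraicGeometry.AbelianVarieties

open Literature.AlgebraicGeometry.Motives Literature.AlgebraicGeometry.Modules
open Literature.AlgebraicGeometry.AbelianSchemes Literature.AlgebraicGeometry.AbelianSchemes.AbelianSchemeOver

variable {K : Type u} [Field K] [IsAlgClosed K] (B : AbelianVariety K)

/-- **`(−1)^*[Z] = [Z]⁻¹` for a translation-invariant divisor class** ([MumfordAV1970] §8 (iii) with `f = 1`, `g = −1`: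
`[Z]·(−1)^*[Z] = (1·1⁻¹)^*[Z] = 0^*[Z] = 1`). [cite: MumfordAV1970, §8 (ii)–(iv) (pp. 74–75)] -/
theorem cechClass_classPullback_inv_eq_inv (Z : CartierDivisor B.X.left)
    (hZ : ∀ P : B.Points K, (Z.pullback (B.translation P).left).LinEquiv Z) :
    (Z.classPullback ((𝟙 B.X)⁻¹ : B.X ⟶ B.X).left).cechClass = Z.cechClass⁻¹ := by
  haveI : IsIso (((𝟙 B.X)⁻¹ : B.X ⟶ B.X).left) := by rw [← B.zsmulPt_neg_one_eq_inv]; infer_instance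
  have hL : IsHomogeneous B (lineBundle Z.toUnitCocycle) := (isHomogeneous_lineBundle_iff_forall_linEquiv B Z).2 hZ
  have key := cechPic_pullback_hom_mul_detClass B Z.toUnitCocycle.hasRank_lineBundle
    Z.toUnitCocycle.isFiniteLocallyFree_lineBundle hL (𝟙 B.X) ((𝟙 B.X)⁻¹)
  have h0 := cechPic_pullback_pow_id_detClass B Z.toUnitCocycle.hasRank_lineBundle
    Z.toUnitCocycle.isFiniteLocallyFree_lineBundle hL 0
  rw [pow_zero, pow_zero, ← mul_inv_cancel (𝟙 B.X), key, detClass_lineBundle_toUnitCocycle, Over.id_left,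
    CechPic.pullback_id_apply, ← CartierDivisor.cechClass_classPullback] at h0
  exact eq_inv_of_mul_eq_one_right h0

/-- **A translation-invariant symmetric divisor class is `2`-torsion**: `t_P^*Z ∼ Z` for all `P ∈ B(K)` and `(−1)^*Z ∼ Z` imply
`2 • Z ∼ 0` (`[Z]² = [Z]·(−1)^*[Z] = 1`). [cite: MumfordAV1970, §8 (ii)–(iv) (pp. 74–75)] -/
theorem two_smul_linEquiv_zero_of_translationInvariant_of_symmetric (Z : CartierDivisor B.X.left)
    (hZ : ∀ P : B.Points K, (Z.pullback (B.translation P).left).LinEquiv Z)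
    (hsym : (Z.classPullback ((𝟙 B.X)⁻¹ : B.X ⟶ B.X).left).LinEquiv Z) : (2 • Z).LinEquiv 0 := by
  rw [← CartierDivisor.cechClass_eq_iff_linEquiv, cechClass_smul', CartierDivisor.cechClass_zero, pow_two]
  have h := cechClass_classPullback_inv_eq_inv B Z hZ
  rw [(CartierDivisor.cechClass_eq_iff_linEquiv _ _).2 hsym] at h
  -- `[Z] = [Z]⁻¹`
  nth_rw 2 [h]
  exact mul_inv_cancel _

/-- **The shape consumed by ★ `exists_isAmple_isLambdaOfAt_bezout`**: if `Z := m • ΘB + (−Θ₀)` is `2`-torsion then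
`(2m) • ΘB ∼ 2 • Θ₀`. [cite: MumfordAV1970, §8 (ii)–(iv) (pp. 74–75)] -/
theorem smul_linEquiv_smul_of_sub_two_torsion {X : Scheme.{u}} [IsIntegral X] (ΘB Θ₀ : CartierDivisor X) (m : ℕ)
    (h : (2 • (m • ΘB + -Θ₀)).LinEquiv 0) : ((2 * m) • ΘB).LinEquiv (2 • Θ₀) := by
  rw [← CartierDivisor.cechClass_eq_iff_linEquiv] at h ⊢
  rw [cechClass_smul', CartierDivisor.cechClass_add, cechClass_smul', cechClass_neg_eq_inv', CartierDivisor.cechClass_zero,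
    mul_pow, inv_pow, mul_inv_eq_one] at h
  rw [cechClass_smul', cechClass_smul', pow_mul', h]

end Literature.AlgebraicGeometry.AbelianVarieties

end
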